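import Literature.Algebra.Homology.MorseInequalities
import Mathlib.Algebra.Polynomial.Laurent
import HarnessLib

/-!
# The Poincaré–Morse polynomial identity `M(T) − P(T) = (1 + T)·Q(T)` for a bounded complex

Layer `Literature/Algebra/Homology` (proved theorems only, 0 definitions, 0 named facts, no instances, no notation). A COROLLARY
FILE of row `MorseInequalities`: for a `ℤ`-(co)chain complex of finite-dimensional vector spaces over a division ring with
`Cⁿ = 0` off `Icc a b`, the generating-function form of the strong Morse inequalities in `ℤ[T;T⁻¹]` (`LaurentPolynomial ℤ`):
* cochain: **`sum_finrank_sub_mul_T_eq`** — `Σ_{n ∈ Icc a b} (dim Cⁿ − dim Hⁿ)·Tⁿ = (1 + T)·Σ_{n ∈ Icc a b} rk(dⁿ : Cⁿ → Cⁿ⁺¹)·Tⁿ`;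
* chain: **`sum_finrank_sub_mul_T_eq_chain`** — `Σ_{k ∈ Icc a b} (dim Cₖ − dim Hₖ)·Tᵏ = (1 + T)·Σ_{k ∈ Icc a b} rk(∂ₖ₊₁ : Cₖ₊₁ → Cₖ)·Tᵏ`;
* the lacunary principle `finrank_homology_eq_of_isZero` (`Cⁿ⁻¹ = 0 = Cⁿ⁺¹ ⇒ dim Hⁿ = dim Cⁿ`).

All BY NAME from row `MorseInequalities` (`finrank_X_eq_cochain` / `finrank_X_eq_chain`, `finrank_range_eq_zero_of_isZero`); no
induction is re-run: the `dⁿ⁻¹`-sum is re-indexed along `n ↦ n − 1` and the two boundary ranks vanish. `T = −1` gives row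
`EulerPoincareFormula`, truncation gives row `MorseInequalities`; neither is restated.
Library only (cell `pub-hodge-ring2`, count-neutral); proves nothing about any crux, route or conjecture.

## References

* J. Milnor, *Morse theory* (1963), §5 (proof of Thm. 5.2: the polynomial form of the Morse inequalities). [Milnor1963]
* R. Forman, Morse theory for cell complexes, Adv. Math. 134 (1998), Cor. 3.6. [Forman1998]
-/

open CategoryTheory CategoryTheory.Limits LaurentPolynomial

universe v u

namespace Literature.Algebra.Homology.MorsePolynomial

variable {K : Type u} [DivisionRing K]

/-- The rank of a linear map into a trivial space is `0`. [cite: Milnor1963, §5] -/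
theorem finrank_range_eq_zero_of_isZero_tgt {X Y : ModuleCat.{v} K} (f : X ⟶ Y) (hY : IsZero Y) :
    Module.finrank K (LinearMap.range f.hom) = 0 := by
  rw [hY.eq_of_tgt f 0, ModuleCat.hom_zero, LinearMap.range_zero, finrank_bot]

/-- Re-indexing a sum over `Icc a b ⊆ ℤ` along `n = m + 1`. [cite: Milnor1963, §5] -/
theorem sum_Icc_eq_sum_Icc_sub_one {M : Type*} [AddCommMonoid M] (a b : ℤ) (g : ℤ → M) :
    ∑ n ∈ Finset.Icc a b, g n = ∑ m ∈ Finset.Icc (a - 1) (b - 1), g (m + 1) := by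
  rw [show Finset.Icc a b = (Finset.Icc (a - 1) (b - 1)).map (addRightEmbedding 1) by
    rw [Finset.map_add_right_Icc, sub_add_cancel, sub_add_cancel], Finset.sum_map]
  rfl

/-- Two sums over `Icc (a − 1) (b − 1)` and `Icc a b` of a function vanishing off `Icc a (b − 1)` agree. [cite: Milnor1963, §5] -/
theorem sum_Icc_sub_one_eq_sum_Icc {M : Type*} [AddCommMonoid M] (a b : ℤ) (g : ℤ → M)
    (hg : ∀ m, m ∉ Finset.Icc a (b - 1) → g m = 0) :
    ∑ m ∈ Finset.Icc (a - 1) (b - 1), g m = ∑ m ∈ Finset.Icc a b, g m := by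
  rw [← Finset.sum_subset (Finset.Icc_subset_Icc (by omega) le_rfl : Finset.Icc a (b - 1) ⊆ Finset.Icc (a - 1) (b - 1))
      (fun m _ hm => hg m hm),
    ← Finset.sum_subset (Finset.Icc_subset_Icc le_rfl (by omega) : Finset.Icc a (b - 1) ⊆ Finset.Icc a b)
      (fun m _ hm => hg m hm)]

section Cochain

variable (C : CochainComplex (ModuleCat.{v} K) ℤ) [∀ n, Module.Finite K (C.X n)] (a b : ℤ)
  (hC : ∀ n, n ∉ Finset.Icc a b → IsZero (C.X n))

omit [∀ n, Module.Finite K (C.X n)] in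
include hC in
/-- The boundary ranks vanish: `rk dᵐ·Tᵐ⁺¹ = 0` for `m ∉ Icc a (b − 1)`. [cite: Milnor1963, §5] -/
theorem finrank_range_d_mul_T_eq_zero (m : ℤ) (hm : m ∉ Finset.Icc a (b - 1)) :
    (Module.finrank K (LinearMap.range (C.d m (m + 1)).hom) : ℤ[T;T⁻¹]) * T (m + 1) = 0 := by
  rw [Finset.mem_Icc, not_and_or, not_le, not_le] at hm
  rcases hm with hm | hm
  · rw [MorseInequalities.finrank_range_eq_zero_of_isZero _ (hC m (by rw [Finset.mem_Icc]; omega)), Nat.cast_zero,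
      zero_mul]
  · rw [finrank_range_eq_zero_of_isZero_tgt _ (hC (m + 1) (by rw [Finset.mem_Icc]; omega)), Nat.cast_zero, zero_mul]

include hC in
/-- **The Poincaré–Morse polynomial identity (cochain form)**: with `Cⁿ = 0` off `Icc a b`,
`Σ_{n ∈ Icc a b} (dim Cⁿ − dim Hⁿ)·Tⁿ = (1 + T)·Σ_{n ∈ Icc a b} rk(dⁿ)·Tⁿ` in `ℤ[T;T⁻¹]`.
[cite: Milnor1963, §5 Thm. 5.2 (proof)] [cite: Forman1998, Cor. 3.6] -/
theorem sum_finrank_sub_mul_T_eq :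
    ∑ n ∈ Finset.Icc a b, ((Module.finrank K (C.X n) : ℤ[T;T⁻¹]) - (Module.finrank K (C.homology n) : ℤ[T;T⁻¹])) * T n =
      (1 + T 1) * ∑ n ∈ Finset.Icc a b, (Module.finrank K (LinearMap.range (C.d n (n + 1)).hom) : ℤ[T;T⁻¹]) * T n := by
  have hdeg : ∀ n : ℤ, (Module.finrank K (C.X n) : ℤ[T;T⁻¹]) - (Module.finrank K (C.homology n) : ℤ[T;T⁻¹]) =
      Module.finrank K (LinearMap.range (C.d n (n + 1)).hom) + Module.finrank K (LinearMap.range (C.d (n - 1) n).hom) :=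
    fun n => by rw [MorseInequalities.finrank_X_eq_cochain C n]; push_cast; ring
  simp_rw [hdeg, add_mul]
  rw [Finset.sum_add_distrib, one_mul, Finset.mul_sum]
  congr 1
  rw [sum_Icc_eq_sum_Icc_sub_one a b fun n =>
      (Module.finrank K (LinearMap.range (C.d (n - 1) n).hom) : ℤ[T;T⁻¹]) * T n,
    Finset.sum_congr rfl fun m _ => by rw [show m + 1 - 1 = m by omega],
    sum_Icc_sub_one_eq_sum_Icc a b _ (finrank_range_d_mul_T_eq_zero C a b hC)]
  refine Finset.sum_congr rfl fun m _ => ?_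
  rw [T_add]
  ring

/-- **Lacunary principle**: if `Cⁿ⁻¹ = 0` and `Cⁿ⁺¹ = 0` then `dim Hⁿ = dim Cⁿ`. [cite: Milnor1963, §5] -/
theorem finrank_homology_eq_of_isZero (n : ℤ) (h₁ : IsZero (C.X (n - 1))) (h₂ : IsZero (C.X (n + 1))) :
    Module.finrank K (C.homology n) = Module.finrank K (C.X n) := by
  have h := MorseInequalities.finrank_X_eq_cochain C n
  rw [finrank_range_eq_zero_of_isZero_tgt _ h₂, MorseInequalities.finrank_range_eq_zero_of_isZero _ h₁] at h
  omega

end Cochain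

section Chain

variable (C : ChainComplex (ModuleCat.{v} K) ℤ) [∀ k, Module.Finite K (C.X k)] (a b : ℤ)
  (hC : ∀ k, k ∉ Finset.Icc a b → IsZero (C.X k))

omit [∀ k, Module.Finite K (C.X k)] in
include hC in
/-- The boundary ranks vanish: `rk ∂ₘ₊₁·Tᵐ⁺¹ = 0` (`∂ₘ₊₁ : Cₘ₊₁ → Cₘ`) for `m ∉ Icc a (b − 1)`. [cite: Milnor1963, §5] -/
theorem finrank_range_d_mul_T_eq_zero_chain (m : ℤ) (hm : m ∉ Finset.Icc a (b - 1)) :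
    (Module.finrank K (LinearMap.range (C.d (m + 1) m).hom) : ℤ[T;T⁻¹]) * T (m + 1) = 0 := by
  rw [Finset.mem_Icc, not_and_or, not_le, not_le] at hm
  rcases hm with hm | hm
  · rw [finrank_range_eq_zero_of_isZero_tgt _ (hC m (by rw [Finset.mem_Icc]; omega)), Nat.cast_zero, zero_mul]
  · rw [MorseInequalities.finrank_range_eq_zero_of_isZero _ (hC (m + 1) (by rw [Finset.mem_Icc]; omega)), Nat.cast_zero,
      zero_mul]

include hC in
/-- **The Poincaré–Morse polynomial identity (chain form)**: with `Cₖ = 0` off `Icc a b`,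
`Σ_{k ∈ Icc a b} (dim Cₖ − dim Hₖ)·Tᵏ = (1 + T)·Σ_{k ∈ Icc a b} rk(∂ₖ₊₁)·Tᵏ` in `ℤ[T;T⁻¹]`.
[cite: Milnor1963, §5 Thm. 5.2 (proof)] [cite: Forman1998, Cor. 3.6] -/
theorem sum_finrank_sub_mul_T_eq_chain :
    ∑ k ∈ Finset.Icc a b, ((Module.finrank K (C.X k) : ℤ[T;T⁻¹]) - (Module.finrank K (C.homology k) : ℤ[T;T⁻¹])) * T k =
      (1 + T 1) * ∑ k ∈ Finset.Icc a b, (Module.finrank K (LinearMap.range (C.d (k + 1) k).hom) : ℤ[T;T⁻¹]) * T k := by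
  have hdeg : ∀ k : ℤ, (Module.finrank K (C.X k) : ℤ[T;T⁻¹]) - (Module.finrank K (C.homology k) : ℤ[T;T⁻¹]) =
      Module.finrank K (LinearMap.range (C.d (k + 1) k).hom) + Module.finrank K (LinearMap.range (C.d k (k - 1)).hom) :=
    fun k => by rw [MorseInequalities.finrank_X_eq_chain C k]; push_cast; ring
  simp_rw [hdeg, add_mul]
  rw [Finset.sum_add_distrib, one_mul, Finset.mul_sum]
  congr 1
  rw [sum_Icc_eq_sum_Icc_sub_one a b fun k =>
      (Module.finrank K (LinearMap.range (C.d k (k - 1)).hom) : ℤ[T;T⁻¹]) * T k,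
    Finset.sum_congr rfl fun m _ => by rw [show m + 1 - 1 = m by omega],
    sum_Icc_sub_one_eq_sum_Icc a b _ (finrank_range_d_mul_T_eq_zero_chain C a b hC)]
  refine Finset.sum_congr rfl fun m _ => ?_
  rw [T_add]
  ring

end Chain

end Literature.Algebra.Homology.MorsePolynomial
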